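import Mathlib.Analysis.Calculus.Deriv.MeanValue
import Mathlib.Analysis.ODE.Gronwall
import Mathlib.Analysis.ODE.ExistUnique
import Mathlib.Topology.UniformSpace.HeineCantor
import Literature.Probability.RandomPlanarGeometry.LoewnerChain
import HarnessLib

/-!
# The chordal Loewner chain: discharges of named facts of `LoewnerChain` (trunk `Stoch`)

Proofs of named facts stated in `Literature/Probability/RandomPlanarGeometry/LoewnerChain.lean`
about solutions `g` of the chordal Loewner equation `ġ = 2/(g - W t)`
(`Literature.Loewner.IsSolution W z g T`).

* `Literature.Loewner.IsSolution.im_eq_zero_holds : IsSolution.im_eq_zero` — **a solution started on the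
  real line stays real** (Lawler (2005), Ch. 4 §4.1 and Rem. 6.6: the Loewner equation restricted
  to `ℝ \ {W t}` is a real ODE). The printed argument is "the field is real on `ℝ`; uniqueness";
  we give a direct proof that needs neither uniqueness nor any regularity of the driving
  function `W`: `y = im g` satisfies `ẏ = im (2/(g - W)) = -2y/|g - W|²` on `[0, T)`, so
  `(y²)˙ = -4y²/|g - W|² ≤ 0`, `y²` is non-increasing on the interval `[0, T)` (Mathlib
  `antitoneOn_of_hasDerivWithinAt_nonpos`) and vanishes at `0`, hence everywhere.
* `Literature.Loewner.IsSolution.eqOn_holds : IsSolution.eqOn` — **uniqueness of the flow** for a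
  continuous driving function (Lawler (2005), Ch. 4 §4.1): on a compact time interval both
  solutions stay `δ`-away from `W` (compactness, `IsSolution.exists_le_norm_sub`), the field is
  `2/δ²`-Lipschitz there (`lipschitzOnWith_vectorField`), and Grönwall's inequality (Mathlib
  `dist_le_of_trajectories_ODE_of_mem`) with initial distance `0` concludes. This makes
  `Loewner.map` (defined by choice among solutions) well defined.

* `Literature.Loewner.swallowingTime_pos_holds : swallowingTime_pos` — **every point `z ≠ W 0` flows
  for a positive time** (Lawler (2005), Ch. 4 §4.1): the Loewner field satisfies the hypotheses
  of the Picard–Lindelöf theorem near a point off the singularity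
  (`isPicardLindelof_vectorField`: on a ball `|x - w₀| ≤ δ/2` around a point with
  `|w₀ - W t₀| ≥ δ`, for times at which `W` has moved by at most `δ/4`, the field is bounded by
  `8/δ` and `32/δ²`-Lipschitz), so local solutions exist from every nearby initial point
  (`exists_local_solution`, Mathlib `IsPicardLindelof` / `ODE.FunSpace`).
* `Literature.Loewner.exists_isSolution_swallowingTime_holds : exists_isSolution_swallowingTime` —
  **existence of the maximal solution** on `[0, T_z)`: patch the solutions alive at each
  `t < T_z`, which agree by uniqueness.
* `Literature.Probability.RandomPlanarGeometry.Loewner.IsSolution.coe_lt_swallowingTime_of_le_norm_sub` — **extension criterion**: a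
  solution with finite lifetime `b` staying `δ`-away from `W` on `[0, b)` is not maximal
  (`b < T_z`; restart at `b - ε/2` and glue); equivalently the maximal solution with finite
  lifetime comes arbitrarily close to the driving function (`IsSolution.exists_norm_sub_lt`):
  "`T_z` is the first time `g_t(z) - W_t` reaches `0`".
* `Literature.Probability.RandomPlanarGeometry.Loewner.isOpen_setOf_lt_swallowingTime` — **`{z | t < T_z}` is open** (lower
  semicontinuity of `z ↦ T_z`, continuous dependence on the initial point: Grönwall on a tube
  around the maximal solution plus the extension criterion); hence the Loewner domains
  `H_t = ℍₒ ∖ K_t` are open (`isOpen_domain`).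
* `Literature.Loewner.IsSolution.im_pos_holds : IsSolution.im_pos` — **points of `ℍₒ` stay in `ℍₒ`**:
  at the first time `s₀` where `y = im g` would vanish, `y e^{2t/δ²}` is non-decreasing on
  `[0, s₀]` (`ẏ = -2y/|g - W|² ≥ -2y/δ²`), contradiction.
* `Literature.Loewner.hull_zero_holds : hull_zero` — **`K_0 = ∅`**.
* `Literature.Probability.RandomPlanarGeometry.Loewner.IsSolution.neg_conj`, `swallowingTime_neg_conj` — the reflection symmetry
  `z ↦ -z̄`, `W ↦ -W` of the flow; `Literature.Probability.RandomPlanarGeometry.Loewner.IsSolution.driving_lt_re`,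
  `IsSolution.re_lt_re`, `swallowingTime_mono_right/left` — **the real flow keeps its side and
  its order, and `x ↦ T_x` is non-decreasing in `|x - W 0|` on each side of the driving point**
  (Lawler (2005), Ch. 4 §4.1, used in §6.2).

These are the first inputs of the analysis of the *real* Loewner flow of SLE_κ (swallowing of
real points, `SLEBoundaryHitting`; the SLE–Bessel bridge of `ItoProcesses`): the processes
`gₜ(x) - Wₜ`, `x` real, are real-valued, do not depend on the choice of solution, live exactly
until they reach `0`, and `x ↦ T_x` is lower semicontinuous.

## Mathlib

We USE `antitoneOn_of_hasDerivWithinAt_nonpos`, `monotoneOn_of_hasDerivWithinAt_nonneg`,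
`HasDerivWithinAt.pow/.mul/.exp/.union/.congr`, `dist_le_of_trajectories_ODE_of_mem` (Grönwall),
`IsPicardLindelof`, `ODE.FunSpace.exists_isFixedPt_next`, `ODE.hasDerivWithinAt_picard_Icc`
(Picard–Lindelöf; we re-export Mathlib's `IsPicardLindelof.exists_eq_forall_mem_Icc_hasDerivWithinAt`
keeping the ball containment of its proof, `exists_forall_mem_closedBall_of_isPicardLindelof`),
`LipschitzOnWith`, `IsCompact.exists_isMinOn`, `IsCompact.uniformContinuousOn_of_continuous`,
`IsClosed.csInf_mem`, `ContinuousOn.preimage_isClosed_of_isClosed`, `Icc_mem_nhdsGE`,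
`HasDerivWithinAt.mono_of_mem_nhdsWithin`, `exists_between` (in `WithTop ℝ≥0`),
`intermediate_value_Icc'`, `Complex.conjCLE`.

## References

* G. F. Lawler, *Conformally Invariant Processes in the Plane*, AMS (2005), Ch. 4 §4.1
  (the chordal Loewner flow), Rem. 6.6 (the flow of real points).
-/

noncomputable section

open Set Filter Topology Complex
open UpperHalfPlane (upperHalfPlaneSet isOpen_upperHalfPlaneSet)
open scoped NNReal

namespace Literature.Probability.RandomPlanarGeometry

namespace Loewner

variable {W : ℝ≥0 → ℝ} {z : ℂ} {g : ℝ → ℂ} {T : WithTop ℝ≥0}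

/-- The time domain `[0, T)` of a solution is order connected (an interval). [folklore] -/
theorem ordConnected_timeDomain (T : WithTop ℝ≥0) :
    OrdConnected {t : ℝ | 0 ≤ t ∧ (t.toNNReal : WithTop ℝ≥0) < T} := by
  refine ⟨fun a ha b hb x hx ↦ ⟨ha.1.trans hx.1, lt_of_le_of_lt ?_ hb.2⟩⟩
  exact WithTop.coe_le_coe.2 (Real.toNNReal_le_toNNReal hx.2)

/-- The imaginary part of the Loewner vector field at a point `w` (real driving value `W t`):
`im (2/(w - W t)) = -2 im w / |w - W t|²`. [folklore] -/
theorem im_vectorField (W : ℝ≥0 → ℝ) (t : ℝ) (w : ℂ) :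
    (vectorField W t w).im = -2 * w.im / Complex.normSq (w - W t.toNNReal) := by
  rw [vectorField_apply, Complex.div_im]
  simp [neg_div, mul_div_assoc]

/-- Discharge of `IsSolution.im_eq_zero`: **a solution of the Loewner equation started on the
real line stays real** (Lawler (2005), Ch. 4 §4.1; Rem. 6.6). Proof: `y = im g` has
`ẏ = -2y/|g - W|²` within `[0, T)`, so `y²` has non-positive derivative there and is
non-increasing (`antitoneOn_of_hasDerivWithinAt_nonpos`); as `y 0 = im z = 0`, `y² ≤ 0` on
`[0, T)`. No continuity of `W` is used. [cite: Lawler2005, Ch. 4 §4.1] -/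
theorem IsSolution.im_eq_zero_holds :
    IsSolution.im_eq_zero (W := W) (z := z) (g := g) (T := T) := by
  intro h hz t ht htT
  set D : Set ℝ := {t : ℝ | 0 ≤ t ∧ (t.toNNReal : WithTop ℝ≥0) < T} with hD
  have hconv : Convex ℝ D := (ordConnected_timeDomain T).convex
  -- `y = im ∘ g` and its derivative within `D`
  have hy : ∀ s ∈ D, HasDerivWithinAt (fun s ↦ (g s).im)
      (-2 * (g s).im / Complex.normSq (g s - W s.toNNReal)) D s := fun s hs ↦ by
    have h1 := h.isIntegralCurveOn s hs
    have h2 : HasDerivWithinAt (fun s ↦ (g s).im) (vectorField W s (g s)).im D s :=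
      Complex.imCLM.hasFDerivAt.comp_hasDerivWithinAt s h1
    rwa [im_vectorField] at h2
  -- `f = y²` is non-increasing on `D`
  have hf : ∀ s ∈ D, HasDerivWithinAt (fun s ↦ (g s).im ^ 2)
      (((2 : ℕ) : ℝ) * (g s).im ^ (2 - 1) *
        (-2 * (g s).im / Complex.normSq (g s - W s.toNNReal))) D s :=
    fun s hs ↦ (hy s hs).pow 2
  have hanti : AntitoneOn (fun s ↦ (g s).im ^ 2) D := by
    refine antitoneOn_of_hasDerivWithinAt_nonpos hconv
      (fun s hs ↦ (hf s hs).continuousWithinAt) (fun s hs ↦ (hf s (interior_subset hs)).mono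
        interior_subset) fun s _ ↦ ?_
    have hns : 0 ≤ Complex.normSq (g s - W s.toNNReal) := Complex.normSq_nonneg _
    rw [mul_div_assoc', show ((2 : ℕ) : ℝ) * (g s).im ^ (2 - 1) * (-2 * (g s).im) =
      -(4 * (g s).im ^ 2) by norm_num; ring, neg_div]
    exact neg_nonpos.2 (div_nonneg (by positivity) hns)
  have h0D : (0 : ℝ) ∈ D := by
    refine ⟨le_rfl, ?_⟩
    rcases eq_or_ne T ⊥ with hT | hT
    · exfalso
      rw [hT] at htT
      exact not_lt_bot htT
    · exact lt_of_le_of_lt (by simp) htT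
  have htD : t ∈ D := ⟨ht, htT⟩
  have hle : (g t).im ^ 2 ≤ (g 0).im ^ 2 := hanti h0D htD ht
  rw [h.apply_zero, hz] at hle
  have h2 : (g t).im ^ 2 = 0 := le_antisymm (by simpa using hle) (sq_nonneg _)
  exact pow_eq_zero_iff (n := 2) (by norm_num) |>.1 h2

/-! ### Uniqueness of the flow -/

/-- The Loewner vector field is Lipschitz away from the singularity: on `{w | δ ≤ |w - W t|}`
(`δ > 0`) the map `w ↦ 2/(w - W t)` is `2/δ²`-Lipschitz, since
`2/(w - W) - 2/(w' - W) = 2(w' - w)/((w - W)(w' - W))`. [folklore] -/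
theorem lipschitzOnWith_vectorField (W : ℝ≥0 → ℝ) (t : ℝ) {δ : ℝ≥0} (hδ : 0 < δ) :
    LipschitzOnWith (2 / δ ^ 2) (vectorField W t)
      {w : ℂ | (δ : ℝ) ≤ ‖w - W t.toNNReal‖} := by
  rw [lipschitzOnWith_iff_norm_sub_le]
  intro w hw w' hw'
  have hδ' : (0 : ℝ) < δ := hδ
  have hw0 : w - W t.toNNReal ≠ 0 := norm_pos_iff.1 (hδ'.trans_le hw)
  have hw'0 : w' - W t.toNNReal ≠ 0 := norm_pos_iff.1 (hδ'.trans_le hw')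
  have hid : vectorField W t w - vectorField W t w' =
      2 * (w' - w) / ((w - W t.toNNReal) * (w' - W t.toNNReal)) := by
    rw [vectorField_apply, vectorField_apply, div_sub_div _ _ hw0 hw'0]
    ring
  rw [hid, norm_div, norm_mul, norm_mul, Complex.norm_two, norm_sub_rev w' w]
  have hprod : (δ : ℝ) ^ 2 ≤ ‖w - W t.toNNReal‖ * ‖w' - W t.toNNReal‖ := by
    rw [sq]
    exact mul_le_mul hw hw' hδ'.le (norm_nonneg _)
  rw [div_le_iff₀ (lt_of_lt_of_le (by positivity) hprod), NNReal.coe_div, NNReal.coe_pow,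
    NNReal.coe_ofNat]
  calc 2 * ‖w - w'‖ = 2 / (δ : ℝ) ^ 2 * ‖w - w'‖ * (δ : ℝ) ^ 2 := by
        field_simp
    _ ≤ 2 / (δ : ℝ) ^ 2 * ‖w - w'‖ * (‖w - W t.toNNReal‖ * ‖w' - W t.toNNReal‖) := by
        gcongr

/-- A solution is continuous on its time domain `[0, T)`. [folklore] -/
theorem IsSolution.continuousOn (h : IsSolution W z g T) :
    ContinuousOn g {t : ℝ | 0 ≤ t ∧ (t.toNNReal : WithTop ℝ≥0) < T} :=
  fun t ht ↦ (h.isIntegralCurveOn t ht).continuousWithinAt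

/-- On a compact time interval `[0, b] ⊆ [0, T)` a solution stays a positive distance `δ` away
from the (continuous) driving function. [folklore] -/
theorem IsSolution.exists_le_norm_sub (hW : Continuous W) (h : IsSolution W z g T) {b : ℝ}
    (hb0 : 0 ≤ b) (hb : (b.toNNReal : WithTop ℝ≥0) < T) :
    ∃ δ : ℝ≥0, 0 < δ ∧ ∀ t ∈ Icc 0 b, (δ : ℝ) ≤ ‖g t - W t.toNNReal‖ := by
  have hsub : Icc 0 b ⊆ {t : ℝ | 0 ≤ t ∧ (t.toNNReal : WithTop ℝ≥0) < T} := fun t ht ↦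
    ⟨ht.1, lt_of_le_of_lt (WithTop.coe_le_coe.2 (Real.toNNReal_le_toNNReal ht.2)) hb⟩
  have hcont : ContinuousOn (fun t ↦ ‖g t - (W t.toNNReal : ℂ)‖) (Icc 0 b) :=
    ((h.continuousOn.mono hsub).sub
      (Complex.continuous_ofReal.comp (hW.comp continuous_real_toNNReal)).continuousOn).norm
  obtain ⟨t₀, ht₀, hmin⟩ :=
    (isCompact_Icc (a := (0 : ℝ)) (b := b)).exists_isMinOn (nonempty_Icc.2 hb0) hcont
  have hpos : 0 < ‖g t₀ - (W t₀.toNNReal : ℂ)‖ :=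
    norm_pos_iff.2 (sub_ne_zero.2 (h.ne ht₀.1 (hsub ht₀).2))
  refine ⟨⟨‖g t₀ - (W t₀.toNNReal : ℂ)‖, hpos.le⟩, hpos, fun t ht ↦ ?_⟩
  exact hmin ht

/-- Discharge of `IsSolution.eqOn`: **uniqueness of the Loewner flow** for a continuous driving
function (Lawler (2005), Ch. 4 §4.1). Two solutions started at `z` agree on `[0, min T T')`: on
each compact `[0, b]` inside, both stay `δ`-away from `W` (`IsSolution.exists_le_norm_sub`),
where the field `2/(w - W t)` is `2/δ²`-Lipschitz (`lipschitzOnWith_vectorField`), so Grönwall's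
inequality with initial distance `0` (Mathlib `dist_le_of_trajectories_ODE_of_mem`) gives
`g = g'` on `[0, b]`. [cite: Lawler2005, Ch. 4 §4.1] -/
theorem IsSolution.eqOn_holds {g' : ℝ → ℂ} {T' : WithTop ℝ≥0} :
    IsSolution.eqOn (W := W) (z := z) (g := g) (g' := g') (T := T) (T' := T') := by
  intro hW h h' b hb
  have hb0 : 0 ≤ b := hb.1
  have hbT : (b.toNNReal : WithTop ℝ≥0) < T := lt_of_lt_of_le hb.2 (min_le_left _ _)
  have hbT' : (b.toNNReal : WithTop ℝ≥0) < T' := lt_of_lt_of_le hb.2 (min_le_right _ _)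
  obtain ⟨δ₁, hδ₁, hg⟩ := h.exists_le_norm_sub hW hb0 hbT
  obtain ⟨δ₂, hδ₂, hg'⟩ := h'.exists_le_norm_sub hW hb0 hbT'
  set δ := min δ₁ δ₂ with hδdef
  have hδ : 0 < δ := lt_min hδ₁ hδ₂
  -- both time domains contain `[0, b]`
  have hsub : Icc 0 b ⊆ {t : ℝ | 0 ≤ t ∧ (t.toNNReal : WithTop ℝ≥0) < T} := fun t ht ↦
    ⟨ht.1, lt_of_le_of_lt (WithTop.coe_le_coe.2 (Real.toNNReal_le_toNNReal ht.2)) hbT⟩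
  have hsub' : Icc 0 b ⊆ {t : ℝ | 0 ≤ t ∧ (t.toNNReal : WithTop ℝ≥0) < T'} := fun t ht ↦
    ⟨ht.1, lt_of_le_of_lt (WithTop.coe_le_coe.2 (Real.toNNReal_le_toNNReal ht.2)) hbT'⟩
  -- derivatives within `Ici t` for `t ∈ [0, b)`
  have hder : ∀ {D : Set ℝ} {f : ℝ → ℂ}, Icc 0 b ⊆ D → IsIntegralCurveOn f (vectorField W) D →
      ∀ t ∈ Ico 0 b, HasDerivWithinAt f (vectorField W t (f t)) (Ici t) t := by
    intro D f hD hf t ht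
    have h1 : HasDerivWithinAt f (vectorField W t (f t)) (Icc t b) t :=
      (hf t (hD ⟨ht.1, ht.2.le⟩)).mono fun s hs ↦ hD ⟨ht.1.trans hs.1, hs.2⟩
    exact h1.mono_of_mem_nhdsWithin (Icc_mem_nhdsGE ht.2)
  have key := dist_le_of_trajectories_ODE_of_mem (v := vectorField W)
    (s := fun t ↦ {w : ℂ | (δ : ℝ) ≤ ‖w - W t.toNNReal‖}) (K := 2 / δ ^ 2) (δ := 0)
    (f := g) (g := g') (a := 0) (b := b)
    (fun t _ ↦ lipschitzOnWith_vectorField W t hδ) (h.continuousOn.mono hsub)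
    (hder hsub h.isIntegralCurveOn)
    (fun t ht ↦ (min_le_left _ _).trans (hg t ⟨ht.1, ht.2.le⟩)) (h'.continuousOn.mono hsub')
    (hder hsub' h'.isIntegralCurveOn)
    (fun t ht ↦ (min_le_right _ _).trans (hg' t ⟨ht.1, ht.2.le⟩))
    (by rw [h.apply_zero, h'.apply_zero, dist_self])
  have := key b ⟨hb0, le_rfl⟩
  rw [zero_mul] at this
  exact dist_le_zero.1 this


/-! ### Local existence: Picard–Lindelöf for the Loewner field -/

section LocalExistence

/-- Picard–Lindelöf existence with values in the ball of validity: Mathlib's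
`IsPicardLindelof.exists_eq_forall_mem_Icc_hasDerivWithinAt`, keeping the information (present in
its proof, `ODE.FunSpace.compProj_mem_closedBall`) that the solution stays in `closedBall x₀ a`.
[folklore] -/
theorem exists_forall_mem_closedBall_of_isPicardLindelof
    {E : Type*} [NormedAddCommGroup E] [NormedSpace ℝ E] [CompleteSpace E]
    {f : ℝ → E → E} {tmin tmax : ℝ} {t₀ : Icc tmin tmax} {x₀ x : E} {a r L K : ℝ≥0}
    (hf : IsPicardLindelof f t₀ x₀ a r L K) (hx : x ∈ Metric.closedBall x₀ r) :
    ∃ α : ℝ → E, α t₀ = x ∧ (∀ t, α t ∈ Metric.closedBall x₀ a) ∧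
      ∀ t ∈ Icc tmin tmax, HasDerivWithinAt α (f t (α t)) (Icc tmin tmax) t := by
  obtain ⟨α, hα⟩ := ODE.FunSpace.exists_isFixedPt_next hf hx
  refine ⟨α.compProj, ?_, fun t ↦ α.compProj_mem_closedBall hf.mul_max_le, fun t ht ↦ ?_⟩
  · rw [ODE.FunSpace.compProj_val, ← hα, ODE.FunSpace.next_apply₀]
  · apply ODE.hasDerivWithinAt_picard_Icc t₀.2 hf.continuousOn_uncurry
      α.continuous_compProj.continuousOn (fun _ _ ↦ α.compProj_mem_closedBall hf.mul_max_le)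
      x ht |>.congr_of_mem _ ht
    intro t' ht'
    nth_rw 1 [← hα]
    rw [ODE.FunSpace.compProj_of_mem ht', ODE.FunSpace.next_apply]

/-- Lower bound for the distance to the singularity in a ball around a point `w₀` with
`δ ≤ |w₀ - W t₀|`, at times where the driving function has moved by at most `δ/4`:
for `|x - w₀| ≤ δ/2`, `|x - W s| ≥ δ/4`. [folklore] -/
theorem norm_sub_driving_ge {W : ℝ≥0 → ℝ} {t₀ s : ℝ} {w₀ x : ℂ} {δ : ℝ}
    (hw₀ : δ ≤ ‖w₀ - W t₀.toNNReal‖) (hs : |W s.toNNReal - W t₀.toNNReal| ≤ δ / 4)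
    (hx : ‖x - w₀‖ ≤ δ / 2) : δ / 4 ≤ ‖x - W s.toNNReal‖ := by
  have h1 : ‖w₀ - (W t₀.toNNReal : ℂ)‖ ≤ ‖x - (W s.toNNReal : ℂ)‖ + ‖x - w₀‖ +
      ‖(W s.toNNReal : ℂ) - W t₀.toNNReal‖ := by
    calc ‖w₀ - (W t₀.toNNReal : ℂ)‖
        = ‖(x - W s.toNNReal) - (x - w₀) + (W s.toNNReal - W t₀.toNNReal)‖ := by ring_nf
      _ ≤ ‖(x - W s.toNNReal) - (x - w₀)‖ + ‖(W s.toNNReal : ℂ) - W t₀.toNNReal‖ :=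
          norm_add_le _ _
      _ ≤ _ := by gcongr; exact norm_sub_le _ _
  have h2 : ‖(W s.toNNReal : ℂ) - W t₀.toNNReal‖ = |W s.toNNReal - W t₀.toNNReal| := by
    rw [← Complex.ofReal_sub, Complex.norm_real, Real.norm_eq_abs]
  rw [h2] at h1
  linarith

/-- **The Loewner field satisfies the Picard–Lindelöf hypotheses** near a point off the
singularity. If `δ ≤ |w₀ - W t₀|` (`δ > 0`), the driving function moves by at most `δ/4` on
`[t₀, t₁]` and `(8/δ)(t₁ - t₀) ≤ δ/4`, then on the time interval `[t₀, t₁]` and the ball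
`closedBall w₀ (δ/2)` the field `2/(z - W t)` is bounded by `8/δ`, `32/δ²`-Lipschitz and
continuous in `t`, with initial points allowed in `closedBall w₀ (δ/4)`. [folklore] -/
theorem isPicardLindelof_vectorField (hW : Continuous W) {t₀ t₁ : ℝ} (ht : t₀ ≤ t₁) {w₀ : ℂ}
    {δ : ℝ≥0} (hδ : 0 < δ) (hw₀ : (δ : ℝ) ≤ ‖w₀ - W t₀.toNNReal‖)
    (hmod : ∀ s ∈ Icc t₀ t₁, |W s.toNNReal - W t₀.toNNReal| ≤ δ / 4)
    (hlen : 8 / (δ : ℝ) * (t₁ - t₀) ≤ δ / 4) :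
    IsPicardLindelof (vectorField W) (⟨t₀, le_rfl, ht⟩ : Icc t₀ t₁) w₀ (δ / 2) (δ / 4) (8 / δ)
      (2 / (δ / 4) ^ 2) where
  lipschitzOnWith s hs := by
    refine (lipschitzOnWith_vectorField W s (δ := δ / 4) (by positivity)).mono fun x hx ↦ ?_
    have hx' : ‖x - w₀‖ ≤ δ / 2 := by simpa [dist_eq_norm] using hx
    simpa using norm_sub_driving_ge hw₀ (hmod s hs) hx'
  continuousOn x hx := by
    have hx' : ‖x - w₀‖ ≤ δ / 2 := by simpa [dist_eq_norm] using hx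
    have hcont : Continuous fun s : ℝ ↦ (W s.toNNReal : ℂ) :=
      Complex.continuous_ofReal.comp (hW.comp continuous_real_toNNReal)
    refine ContinuousOn.div continuousOn_const (continuousOn_const.sub hcont.continuousOn) ?_
    intro s hs h0
    have hge := norm_sub_driving_ge hw₀ (hmod s hs) hx'
    rw [h0, norm_zero] at hge
    have : (0 : ℝ) < δ := hδ
    linarith
  norm_le s hs x hx := by
    have hx' : ‖x - w₀‖ ≤ δ / 2 := by simpa [dist_eq_norm] using hx
    have hge := norm_sub_driving_ge hw₀ (hmod s hs) hx'
    have hδ' : (0 : ℝ) < δ := hδ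
    have hpos : 0 < ‖x - (W s.toNNReal : ℂ)‖ := lt_of_lt_of_le (by positivity) hge
    rw [vectorField_apply, norm_div, Complex.norm_two, NNReal.coe_div, NNReal.coe_ofNat,
      div_le_div_iff₀ hpos hδ']
    linarith
  mul_max_le := by
    have hmax : max (t₁ - t₀) (t₀ - t₀) = t₁ - t₀ := by
      rw [sub_self]
      exact max_eq_left (sub_nonneg.2 ht)
    rw [hmax]
    push_cast
    linarith

/-- **Local solutions of the Loewner equation** near a point off the singularity, from any nearby
initial point: under the hypotheses of `isPicardLindelof_vectorField`, for every `x` with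
`|x - w₀| ≤ δ/4` there is a solution `α` on `[t₀, t₁]` with `α t₀ = x`, staying in
`closedBall w₀ (δ/2)` and hence at distance `≥ δ/4` from the driving function.
(Picard–Lindelöf; Lawler (2005), Ch. 4 §4.1.) [cite: Lawler2005, Ch. 4 §4.1] -/
theorem exists_local_solution (hW : Continuous W) {t₀ t₁ : ℝ} (ht : t₀ ≤ t₁) {w₀ : ℂ}
    {δ : ℝ≥0} (hδ : 0 < δ) (hw₀ : (δ : ℝ) ≤ ‖w₀ - W t₀.toNNReal‖)
    (hmod : ∀ s ∈ Icc t₀ t₁, |W s.toNNReal - W t₀.toNNReal| ≤ δ / 4)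
    (hlen : 8 / (δ : ℝ) * (t₁ - t₀) ≤ δ / 4) {x : ℂ} (hx : ‖x - w₀‖ ≤ δ / 4) :
    ∃ α : ℝ → ℂ, α t₀ = x ∧ (∀ s ∈ Icc t₀ t₁, (δ : ℝ) / 4 ≤ ‖α s - W s.toNNReal‖) ∧
      (∀ s, ‖α s - w₀‖ ≤ δ / 2) ∧
      ∀ s ∈ Icc t₀ t₁, HasDerivWithinAt α (vectorField W s (α s)) (Icc t₀ t₁) s := by
  have hPL := isPicardLindelof_vectorField hW ht hδ hw₀ hmod hlen
  obtain ⟨α, hα0, hball, hder⟩ := exists_forall_mem_closedBall_of_isPicardLindelof hPL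
    (x := x) (by simpa [dist_eq_norm] using hx)
  have hball' : ∀ s, ‖α s - w₀‖ ≤ δ / 2 := fun s ↦ by simpa [dist_eq_norm] using hball s
  exact ⟨α, hα0, fun s hs ↦ norm_sub_driving_ge hw₀ (hmod s hs) (hball' s), hball', hder⟩

/-- Uniform continuity of the driving function on compact time intervals, in the form used
here: on `[0, c]`, for every `η > 0` there is `ε > 0` with `|W s - W t| ≤ η` whenever
`s, t ∈ [0, c]`, `|s - t| ≤ ε`. [folklore] -/
theorem exists_forall_abs_sub_driving_le (hW : Continuous W) (c : ℝ) {η : ℝ} (hη : 0 < η) :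
    ∃ ε > 0, ∀ s ∈ Icc (0 : ℝ) c, ∀ t ∈ Icc (0 : ℝ) c, |s - t| ≤ ε →
      |W s.toNNReal - W t.toNNReal| ≤ η := by
  have hcont : Continuous fun s : ℝ ↦ W s.toNNReal := hW.comp continuous_real_toNNReal
  have huc : UniformContinuousOn (fun s : ℝ ↦ W s.toNNReal) (Icc 0 c) :=
    isCompact_Icc.uniformContinuousOn_of_continuous hcont.continuousOn
  rw [Metric.uniformContinuousOn_iff_le] at huc
  obtain ⟨ε, hε, h⟩ := huc η hη
  refine ⟨ε / 2, half_pos hε, fun s hs t ht hst ↦ ?_⟩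
  have := h s hs t ht (by rw [Real.dist_eq]; linarith)
  rwa [Real.dist_eq] at this

/-- The time domain `[0, ↑b)` of a solution with finite lifetime `b : ℝ≥0`, unfolded. [folklore] -/
theorem mem_timeDomain_coe_iff {b : ℝ≥0} {t : ℝ} :
    t ∈ {t : ℝ | 0 ≤ t ∧ (t.toNNReal : WithTop ℝ≥0) < (b : WithTop ℝ≥0)} ↔ 0 ≤ t ∧ t < b := by
  simp only [mem_setOf_eq, WithTop.coe_lt_coe]
  constructor
  · rintro ⟨h0, h⟩
    exact ⟨h0, (Real.toNNReal_lt_iff_lt_coe h0).1 h⟩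
  · rintro ⟨h0, h⟩
    exact ⟨h0, (Real.toNNReal_lt_iff_lt_coe h0).2 h⟩

/-- Discharge of `swallowingTime_pos`: **every point `z ≠ W 0` flows for a positive time** under
the Loewner equation with continuous driving function (Lawler (2005), Ch. 4 §4.1): a local
solution on a short interval `[0, ε]` exists by Picard–Lindelöf (`exists_local_solution`).
[cite: Lawler2005, Ch. 4 §4.1] -/
theorem swallowingTime_pos_holds : swallowingTime_pos (W := W) (z := z) := by
  intro hW hz
  -- `δ = |z - W 0| > 0`
  have hδpos : 0 < ‖z - (W 0 : ℂ)‖ := norm_pos_iff.2 (sub_ne_zero.2 hz)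
  set δ : ℝ≥0 := ⟨‖z - (W 0 : ℂ)‖, hδpos.le⟩ with hδdef
  have hδ : 0 < δ := hδpos
  have hδ' : (0 : ℝ) < δ := hδpos
  -- modulus of continuity of `W` at `0` and the length constraint
  obtain ⟨ε₁, hε₁, hmod₁⟩ := exists_forall_abs_sub_driving_le hW 1 (η := δ / 4) (by positivity)
  set ε : ℝ := min (min ε₁ 1) ((δ : ℝ) ^ 2 / 32) with hεdef
  have hε : 0 < ε := lt_min (lt_min hε₁ one_pos) (by positivity)
  have hε₁' : ε ≤ ε₁ := (min_le_left _ _).trans (min_le_left _ _)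
  have hε1 : ε ≤ 1 := (min_le_left _ _).trans (min_le_right _ _)
  have hεδ : ε ≤ (δ : ℝ) ^ 2 / 32 := min_le_right _ _
  have hw₀ : (δ : ℝ) ≤ ‖z - W (0 : ℝ).toNNReal‖ := by
    rw [Real.toNNReal_zero]
    exact le_rfl
  have hmod : ∀ s ∈ Icc (0 : ℝ) ε, |W s.toNNReal - W (0 : ℝ).toNNReal| ≤ δ / 4 := fun s hs ↦
    hmod₁ s ⟨hs.1, hs.2.trans hε1⟩ 0 ⟨le_rfl, zero_le_one⟩
      (by rw [sub_zero, abs_of_nonneg hs.1]; exact hs.2.trans hε₁')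
  have hlen : 8 / (δ : ℝ) * (ε - 0) ≤ δ / 4 := by
    rw [sub_zero, div_mul_eq_mul_div, div_le_iff₀ hδ']
    have : 8 * ε ≤ (δ : ℝ) ^ 2 / 4 := by linarith
    nlinarith
  obtain ⟨α, hα0, hfar, -, hder⟩ :=
    exists_local_solution hW hε.le hδ hw₀ hmod hlen (x := z) (by simp; positivity)
  -- `α` is a solution with lifetime `ε/2`
  set b : ℝ≥0 := ⟨ε / 2, (half_pos hε).le⟩ with hbdef
  have hsub : {t : ℝ | 0 ≤ t ∧ (t.toNNReal : WithTop ℝ≥0) < (b : WithTop ℝ≥0)} ⊆ Icc 0 ε := by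
    intro t ht
    rw [mem_timeDomain_coe_iff] at ht
    have ht2 : t < ε / 2 := ht.2
    exact ⟨ht.1, by linarith⟩
  have hsol : IsSolution W z α b := by
    refine ⟨hα0, fun t ht ↦ (hder t (hsub ht)).mono hsub, fun t ht htb h0 ↦ ?_⟩
    have := hfar t (hsub ⟨ht, htb⟩)
    rw [h0, sub_self, norm_zero] at this
    linarith
  calc (0 : WithTop ℝ≥0) < b := by
        rw [← WithTop.coe_zero, WithTop.coe_lt_coe]
        exact half_pos hε
    _ ≤ swallowingTime W z := hsol.le_swallowingTime

end LocalExistence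


/-! ### The maximal solution -/

section Maximal

/-- The set of times `s` with `s⁺ < T'` is a neighbourhood of each of its points. [folklore] -/
theorem setOf_toNNReal_lt_mem_nhds {t : ℝ} {T' : WithTop ℝ≥0}
    (h : (t.toNNReal : WithTop ℝ≥0) < T') : {s : ℝ | (s.toNNReal : WithTop ℝ≥0) < T'} ∈ 𝓝 t := by
  cases T' with
  | top => exact Filter.univ_mem' fun s ↦ WithTop.coe_lt_top _
  | coe c =>
    have htc' : t.toNNReal < c := WithTop.coe_lt_coe.1 h
    have htc : t < c := lt_of_le_of_lt (Real.le_coe_toNNReal t) (NNReal.coe_lt_coe.2 htc')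
    have hc : (0 : ℝ) < c := lt_of_le_of_lt t.toNNReal.coe_nonneg (NNReal.coe_lt_coe.2 htc')
    filter_upwards [Iio_mem_nhds htc] with s hs
    simp only [WithTop.coe_lt_coe]
    rw [← NNReal.coe_lt_coe, Real.coe_toNNReal']
    exact max_lt hs hc

/-- Discharge of `exists_isSolution_swallowingTime`: **existence of the maximal solution** of the
Loewner equation for a continuous driving function (Lawler (2005), Ch. 4 §4.1). For each time
`t < T_z` some solution is alive at `t` (definition of `T_z` as a supremum); by uniqueness
(`IsSolution.eqOn_holds`) these solutions agree wherever they are jointly defined, so evaluating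
at `t` the solution chosen for `t` defines a solution on all of `[0, T_z)`.
[cite: Lawler2005, Ch. 4 §4.1] -/
theorem exists_isSolution_swallowingTime_holds :
    exists_isSolution_swallowingTime (W := W) (z := z) := by
  intro hW _
  classical
  set D : Set ℝ := {t : ℝ | 0 ≤ t ∧ (t.toNNReal : WithTop ℝ≥0) < swallowingTime W z} with hD
  have hex : ∀ t : ℝ, t ∈ D → ∃ p : (ℝ → ℂ) × WithTop ℝ≥0, IsSolution W z p.1 p.2 ∧
      (t.toNNReal : WithTop ℝ≥0) < p.2 := by
    intro t ht
    obtain ⟨T', ⟨g', hg'⟩, htT'⟩ := lt_sSup_iff.1 ht.2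
    exact ⟨(g', T'), hg', htT'⟩
  choose! p hp using hex
  refine ⟨fun t ↦ if t ∈ D then (p t).1 t else z, ?_, fun t ht ↦ ?_, fun t ht htT ↦ ?_⟩
  · by_cases h0 : (0 : ℝ) ∈ D
    · simp only [h0, if_true]
      exact (hp 0 h0).1.apply_zero
    · simp only [h0, if_false]
  · obtain ⟨hsol, htt⟩ := hp t ht
    have hagree : ∀ s ∈ D ∩ {s : ℝ | (s.toNNReal : WithTop ℝ≥0) < (p t).2},
        (if s ∈ D then (p s).1 s else z) = (p t).1 s := by
      rintro s ⟨hsD, hsT⟩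
      rw [if_pos hsD]
      obtain ⟨hsol', hss⟩ := hp s hsD
      exact IsSolution.eqOn_holds hW hsol' hsol ⟨hsD.1, lt_min hss hsT⟩
    have hmem : D ∩ {s : ℝ | (s.toNNReal : WithTop ℝ≥0) < (p t).2} ∈ 𝓝[D] t :=
      inter_mem_nhdsWithin D (setOf_toNNReal_lt_mem_nhds htt)
    have h1 : HasDerivWithinAt (p t).1 (vectorField W t ((p t).1 t))
        (D ∩ {s : ℝ | (s.toNNReal : WithTop ℝ≥0) < (p t).2}) t :=
      (hsol.isIntegralCurveOn t ⟨ht.1, htt⟩).mono fun s hs ↦ ⟨hs.1.1, hs.2⟩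
    have h2 : HasDerivWithinAt (fun s ↦ if s ∈ D then (p s).1 s else z)
        (vectorField W t ((p t).1 t)) (D ∩ {s : ℝ | (s.toNNReal : WithTop ℝ≥0) < (p t).2}) t :=
      h1.congr (fun s hs ↦ hagree s hs) (hagree t ⟨ht, htt⟩)
    have hGt : (if t ∈ D then (p t).1 t else z) = (p t).1 t := hagree t ⟨ht, htt⟩
    dsimp only
    rw [hGt]
    exact h2.mono_of_mem_nhdsWithin hmem
  · dsimp only
    rw [if_pos ⟨ht, htT⟩]
    obtain ⟨hsol, htt⟩ := hp t ⟨ht, htT⟩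
    exact hsol.ne ht htt

/-- No flow starts at the singularity: `T_{W 0} ≤ 0` (a solution must avoid `W` at time `0`).
[folklore] -/
theorem swallowingTime_driving_le (W : ℝ≥0 → ℝ) : swallowingTime W (W 0) ≤ 0 := by
  refine sSup_le fun T ⟨g, hg⟩ ↦ not_lt.1 fun hT ↦ ?_
  have h := hg.ne le_rfl (by simpa using hT)
  rw [hg.apply_zero, Real.toNNReal_zero] at h
  exact h rfl

/-- A point with positive swallowing time is off the singularity. [folklore] -/
theorem ne_driving_of_lt_swallowingTime {t : WithTop ℝ≥0} (h : t < swallowingTime W z) :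
    z ≠ W 0 := by
  rintro rfl
  have := h.trans_le (swallowingTime_driving_le W)
  exact not_lt_bot (this.trans_le bot_le.ge)

end Maximal

/-! ### Extension past a regular endpoint; openness of `{z | t < T_z}` -/

section Extension

/-- One-sided derivatives of a solution: within `[t, ∞)` at every `t ∈ [0, b)` when
`[0, b] ⊆ [0, T)`. [folklore] -/
theorem IsSolution.hasDerivWithinAt_Ici (h : IsSolution W z g T) {b : ℝ}
    (hb : Icc 0 b ⊆ {t : ℝ | 0 ≤ t ∧ (t.toNNReal : WithTop ℝ≥0) < T}) :
    ∀ t ∈ Ico 0 b, HasDerivWithinAt g (vectorField W t (g t)) (Ici t) t := by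
  intro t ht
  have h1 : HasDerivWithinAt g (vectorField W t (g t)) (Icc t b) t :=
    (h.isIntegralCurveOn t (hb ⟨ht.1, ht.2.le⟩)).mono fun s hs ↦ hb ⟨ht.1.trans hs.1, hs.2⟩
  exact h1.mono_of_mem_nhdsWithin (Icc_mem_nhdsGE ht.2)

/-- `[0, b] ⊆ [0, T)` when `b⁺ < T`. [folklore] -/
theorem Icc_subset_timeDomain {b : ℝ} (hb : (b.toNNReal : WithTop ℝ≥0) < T) :
    Icc 0 b ⊆ {t : ℝ | 0 ≤ t ∧ (t.toNNReal : WithTop ℝ≥0) < T} := fun _ ht ↦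
  ⟨ht.1, lt_of_le_of_lt (WithTop.coe_le_coe.2 (Real.toNNReal_le_toNNReal ht.2)) hb⟩

/-- **Extension past a regular endpoint.** A solution of the Loewner equation with finite
lifetime `b > 0` that stays `δ`-away (`δ > 0`) from the (continuous) driving function on
`[0, b)` is not maximal: `b < T_z`. Proof: restart the equation at `t₀ = b - ε/2` from `g t₀`
(`exists_local_solution` on `[t₀, t₀ + ε]`, `ε` small in terms of `δ` and the modulus of
continuity of `W` on `[0, b + 1]`) and glue. This is the extension criterion behind "the
solution exists up to the first time `g_t(z) - W_t` hits `0`" (Lawler (2005), Ch. 4 §4.1).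
[cite: Lawler2005, Ch. 4 §4.1] -/
theorem IsSolution.coe_lt_swallowingTime_of_le_norm_sub (hW : Continuous W) {b : ℝ≥0}
    (hb : 0 < b) (h : IsSolution W z g b) {δ : ℝ≥0} (hδ : 0 < δ)
    (hfar : ∀ t : ℝ, 0 ≤ t → t < b → (δ : ℝ) ≤ ‖g t - W t.toNNReal‖) :
    (b : WithTop ℝ≥0) < swallowingTime W z := by
  have hδ' : (0 : ℝ) < δ := hδ
  have hb' : (0 : ℝ) < b := hb
  -- uniform continuity of `W` on `[0, b + 1]`, and the small time step `ε`
  obtain ⟨ε₁, hε₁, hmod₁⟩ :=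
    exists_forall_abs_sub_driving_le hW ((b : ℝ) + 1) (η := δ / 4) (by positivity)
  set ε : ℝ := min (min ε₁ 1) (min (b : ℝ) ((δ : ℝ) ^ 2 / 32)) with hεdef
  have hε : 0 < ε := lt_min (lt_min hε₁ one_pos) (lt_min hb' (by positivity))
  have hε₁' : ε ≤ ε₁ := (min_le_left _ _).trans (min_le_left _ _)
  have hε1 : ε ≤ 1 := (min_le_left _ _).trans (min_le_right _ _)
  have hεb : ε ≤ b := (min_le_right _ _).trans (min_le_left _ _)
  have hεδ : ε ≤ (δ : ℝ) ^ 2 / 32 := (min_le_right _ _).trans (min_le_right _ _)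
  set t₀ : ℝ := b - ε / 2 with ht₀def
  set t₁ : ℝ := t₀ + ε with ht₁def
  have ht₀0 : 0 ≤ t₀ := by rw [ht₀def]; linarith
  have ht₀b : t₀ < b := by rw [ht₀def]; linarith
  have ht₁b : t₁ = b + ε / 2 := by rw [ht₁def, ht₀def]; ring
  have ht₀₁ : t₀ ≤ t₁ := by rw [ht₁def]; linarith
  -- the local solution from `g t₀` at time `t₀`
  have hw₀ : (δ : ℝ) ≤ ‖g t₀ - W t₀.toNNReal‖ := hfar t₀ ht₀0 ht₀b
  have hmod : ∀ s ∈ Icc t₀ t₁, |W s.toNNReal - W t₀.toNNReal| ≤ δ / 4 := fun s hs ↦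
    hmod₁ s ⟨ht₀0.trans hs.1, by rw [ht₁b] at hs; linarith [hs.2]⟩ t₀ ⟨ht₀0, by linarith⟩
      (by rw [abs_of_nonneg (by linarith [hs.1]), ht₁def] at *; linarith [hs.2])
  have hlen : 8 / (δ : ℝ) * (t₁ - t₀) ≤ δ / 4 := by
    rw [show t₁ - t₀ = ε by rw [ht₁def]; ring, div_mul_eq_mul_div, div_le_iff₀ hδ']
    have : 8 * ε ≤ (δ : ℝ) ^ 2 / 4 := by linarith
    nlinarith
  obtain ⟨α, hα0, hαfar, -, hαder⟩ :=
    exists_local_solution hW ht₀₁ hδ hw₀ hmod hlen (x := g t₀) (by simp; positivity)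
  -- glue `g` (up to `t₀`) and `α` (after `t₀`)
  set G : ℝ → ℂ := fun s ↦ if s ≤ t₀ then g s else α s with hGdef
  have hb'pos : (0 : ℝ) ≤ b + ε / 2 := by linarith
  set b' : ℝ≥0 := ⟨(b : ℝ) + ε / 2, hb'pos⟩ with hb'def
  set D : Set ℝ := {t : ℝ | 0 ≤ t ∧ (t.toNNReal : WithTop ℝ≥0) < (b : WithTop ℝ≥0)} with hDdef
  set D' : Set ℝ := {t : ℝ | 0 ≤ t ∧ (t.toNNReal : WithTop ℝ≥0) < (b' : WithTop ℝ≥0)} with hD'def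
  have hD'iff : ∀ s, s ∈ D' ↔ 0 ≤ s ∧ s < b + ε / 2 := fun s ↦ mem_timeDomain_coe_iff
  have hDiff : ∀ s, s ∈ D ↔ 0 ≤ s ∧ s < b := fun s ↦ mem_timeDomain_coe_iff
  have hGg : EqOn G g (Iic t₀) := fun s hs ↦ if_pos hs
  have hGα : EqOn G α (Ici t₀) := fun s hs ↦ by
    rcases eq_or_lt_of_le (show t₀ ≤ s from hs) with heq | hs'
    · rw [← heq]
      show (if t₀ ≤ t₀ then g t₀ else α t₀) = α t₀
      rw [if_pos le_rfl, hα0]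
    · exact if_neg (not_le.2 hs')
  -- derivative of `G` from the left of `t₀` (including at `t₀`)
  have hleft : ∀ s, 0 ≤ s → s ≤ t₀ →
      HasDerivWithinAt G (vectorField W s (g s)) (D' ∩ Iic t₀) s := by
    intro s hs0 hst
    have hsub : D' ∩ Iic t₀ ⊆ D := fun u hu ↦ (hDiff u).2 ⟨hu.1.1, lt_of_le_of_lt hu.2 ht₀b⟩
    have h1 : HasDerivWithinAt g (vectorField W s (g s)) (D' ∩ Iic t₀) s :=
      (h.isIntegralCurveOn s ((hDiff s).2 ⟨hs0, lt_of_le_of_lt hst ht₀b⟩)).mono hsub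
    exact h1.congr (fun u hu ↦ hGg hu.2) (hGg hst)
  -- derivative of `G` from the right of `t₀` (including at `t₀`)
  have hright : ∀ s, t₀ ≤ s → s < b + ε / 2 →
      HasDerivWithinAt G (vectorField W s (α s)) (D' ∩ Ici t₀) s := by
    intro s hst hsb
    have hsub : D' ∩ Ici t₀ ⊆ Icc t₀ t₁ := fun u hu ↦
      ⟨hu.2, by rw [ht₁b]; exact ((hD'iff u).1 hu.1).2.le⟩
    have h1 : HasDerivWithinAt α (vectorField W s (α s)) (D' ∩ Ici t₀) s :=
      (hαder s ⟨hst, by rw [ht₁b]; exact hsb.le⟩).mono hsub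
    exact h1.congr (fun u hu ↦ hGα hu.2) (hGα hst)
  have hsolG : IsSolution W z G b' := by
    refine ⟨?_, fun s hs ↦ ?_, fun s hs hsb h0 ↦ ?_⟩
    · rw [hGg ht₀0, h.apply_zero]
    · have hs' := (hD'iff s).1 hs
      rcases lt_trichotomy s t₀ with hlt | heq | hgt
      · have h1 := hleft s hs'.1 hlt.le
        rw [← hGg hlt.le] at h1
        exact h1.mono_of_mem_nhdsWithin (inter_mem_nhdsWithin D' (Iic_mem_nhds hlt))
      · have h1 := hleft s hs'.1 heq.le
        have h2 := hright s heq.ge hs'.2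
        rw [(hGg heq.le).symm] at h1
        rw [(hGα (show t₀ ≤ s from heq.ge)).symm] at h2
        have h3 := h1.union h2
        rwa [← inter_union_distrib_left, Iic_union_Ici, inter_univ] at h3
      · have h1 := hright s hgt.le hs'.2
        rw [← hGα (show t₀ ≤ s from hgt.le)] at h1
        exact h1.mono_of_mem_nhdsWithin
          (inter_mem_nhdsWithin D' (mem_of_superset (Ioi_mem_nhds hgt) Ioi_subset_Ici_self))
    · have hsb' : s < b + ε / 2 := ((hD'iff s).1 ⟨hs, hsb⟩).2
      rcases le_or_gt s t₀ with hst | hst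
      · have hfar' := hfar s hs (lt_of_le_of_lt hst ht₀b)
        rw [← hGg hst, h0, sub_self, norm_zero] at hfar'
        linarith
      · have hfar' := hαfar s ⟨hst.le, by rw [ht₁b]; exact hsb'.le⟩
        rw [← hGα hst.le, h0, sub_self, norm_zero] at hfar'
        linarith
  calc (b : WithTop ℝ≥0) < b' := by
        rw [WithTop.coe_lt_coe, ← NNReal.coe_lt_coe]
        show (b : ℝ) < b + ε / 2
        linarith
    _ ≤ swallowingTime W z := hsolG.le_swallowingTime

/-- **The maximal solution with finite lifetime approaches the driving function**: if `g` solves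
the Loewner equation on `[0, T_z)` with `T_z = b` finite and positive, then
`inf_{t < b} |g t - W t| = 0`, i.e. for every `δ > 0` some `t ∈ [0, b)` has `|g t - W t| < δ`
(contrapositive of `IsSolution.coe_lt_swallowingTime_of_le_norm_sub`). Lawler (2005), Ch. 4 §4.1
("`T_z` is the first time `g_t(z) - W_t` hits `0`"). [cite: Lawler2005, Ch. 4 §4.1] -/
theorem IsSolution.exists_norm_sub_lt (hW : Continuous W) {b : ℝ≥0} (hb : 0 < b)
    (h : IsSolution W z g b) (hmax : swallowingTime W z = b) {δ : ℝ} (hδ : 0 < δ) :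
    ∃ t : ℝ, 0 ≤ t ∧ t < b ∧ ‖g t - W t.toNNReal‖ < δ := by
  by_contra hcon
  have hcon' : ∀ t : ℝ, 0 ≤ t → t < b → ((⟨δ, hδ.le⟩ : ℝ≥0) : ℝ) ≤ ‖g t - W t.toNNReal‖ :=
    fun t ht htb ↦ not_lt.1 fun hlt ↦ hcon ⟨t, ht, htb, hlt⟩
  have := h.coe_lt_swallowingTime_of_le_norm_sub hW hb (δ := ⟨δ, hδ.le⟩) hδ hcon'
  rw [hmax] at this
  exact lt_irrefl _ this

/-- **Openness of `{z | t < T_z}` / lower semicontinuity of the swallowing time** for a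
continuous driving function (continuous dependence on the initial point; Lawler (2005), Ch. 4
§4.1: the domains `H_t = ℍ ∖ K_t` are open). Proof: let `g` be the maximal solution from `z`,
alive on `[0, b]` for some `b > t`, at distance `≥ δ` from `W` there; for `z'` within
`(δ/4) e^{-K b}` of `z` (`K = 8/δ²` the Lipschitz constant of the field on the `δ/2`-tube), the
maximal solution from `z'` stays within `δ/2` of `g` as long as it lives before `b` (Grönwall,
Mathlib `dist_le_of_trajectories_ODE_of_mem`, and a first-exit argument), hence `δ/2`-away from
`W`, so by the extension criterion it cannot die at or before `t`. [cite: Lawler2005, Ch. 4 §4.1] -/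
theorem isOpen_setOf_lt_swallowingTime (hW : Continuous W) (t : ℝ≥0) :
    IsOpen {z : ℂ | (t : WithTop ℝ≥0) < swallowingTime W z} := by
  rw [Metric.isOpen_iff]
  intro z hz
  have hz0 : z ≠ W 0 := ne_driving_of_lt_swallowingTime hz
  obtain ⟨g, hg⟩ := exists_isSolution_swallowingTime_holds hW hz0
  -- a time `b > t` at which `g` is still alive
  obtain ⟨m, htm, hmT⟩ := exists_between (show (t : WithTop ℝ≥0) < swallowingTime W z from hz)
  have hm : m ≠ ⊤ := ne_top_of_lt hmT
  obtain ⟨b, rfl⟩ := WithTop.ne_top_iff_exists.1 hm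
  have htb : t < b := WithTop.coe_lt_coe.1 htm
  have hbT : ((b : ℝ).toNNReal : WithTop ℝ≥0) < swallowingTime W z := by
    rwa [Real.toNNReal_coe]
  obtain ⟨δ, hδ, hfar⟩ := hg.exists_le_norm_sub hW b.coe_nonneg hbT
  have hδ' : (0 : ℝ) < δ := hδ
  -- Lipschitz constant on the `δ/2`-tube and the radius `ρ`
  set K : ℝ≥0 := 2 / (δ / 2) ^ 2 with hKdef
  set ρ : ℝ := (δ : ℝ) / 4 * Real.exp (-((K : ℝ) * b)) with hρdef
  have hρ : 0 < ρ := by positivity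
  have hρδ : ρ ≤ δ / 4 := by
    rw [hρdef]
    have : Real.exp (-((K : ℝ) * b)) ≤ 1 := Real.exp_le_one_iff.2 (by
      have : (0 : ℝ) ≤ K * b := by positivity
      linarith)
    nlinarith
  refine ⟨ρ, hρ, fun z' hz' ↦ ?_⟩
  rw [Metric.mem_ball] at hz'
  -- `z'` is off the singularity
  have hz'0 : z' ≠ W 0 := by
    intro h0
    have h1 := hfar 0 ⟨le_rfl, b.coe_nonneg⟩
    rw [hg.apply_zero, Real.toNNReal_zero] at h1
    have h2 : ‖z - (W 0 : ℂ)‖ ≤ dist z' z := by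
      rw [← h0, dist_comm, dist_eq_norm]
    linarith
  obtain ⟨h, hh⟩ := exists_isSolution_swallowingTime_holds hW hz'0
  by_contra hcon
  simp only [mem_setOf_eq, not_lt] at hcon
  -- the lifetime `c ≤ t < b` of the maximal solution from `z'`
  have hcT : swallowingTime W z' ≠ ⊤ := ne_top_of_le_ne_top WithTop.coe_ne_top hcon
  obtain ⟨c, hc⟩ := WithTop.ne_top_iff_exists.1 hcT
  rw [← hc] at hh hcon
  have hct : c ≤ t := WithTop.coe_le_coe.1 hcon
  have hcb : (c : ℝ) < b := lt_of_le_of_lt (NNReal.coe_le_coe.2 hct) (NNReal.coe_lt_coe.2 htb)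
  have hc0 : 0 < c := by
    have := swallowingTime_pos_holds hW hz'0
    rw [← hc] at this
    exact WithTop.coe_pos.1 this
  -- time domains
  have hDc : ∀ s, s ∈ {t : ℝ | 0 ≤ t ∧ (t.toNNReal : WithTop ℝ≥0) < (c : WithTop ℝ≥0)} ↔
      0 ≤ s ∧ s < c := fun s ↦ mem_timeDomain_coe_iff
  have hsubg : Icc 0 (b : ℝ) ⊆ {t : ℝ | 0 ≤ t ∧ (t.toNNReal : WithTop ℝ≥0) < swallowingTime W z} :=
    Icc_subset_timeDomain hbT
  -- the tube estimate: `dist (h u) (g u) < δ/2` for `u < c`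
  have htube : ∀ u : ℝ, 0 ≤ u → u < c → dist (h u) (g u) < δ / 2 := by
    intro u hu0 huc
    by_contra hnot
    rw [not_lt] at hnot
    have hsubh : Icc 0 u ⊆ {t : ℝ | 0 ≤ t ∧ (t.toNNReal : WithTop ℝ≥0) < (c : WithTop ℝ≥0)} :=
      fun s hs ↦ (hDc s).2 ⟨hs.1, lt_of_le_of_lt hs.2 huc⟩
    have hsubg' : Icc 0 u ⊆ Icc 0 (b : ℝ) := Icc_subset_Icc le_rfl (huc.le.trans hcb.le)
    have hconth : ContinuousOn h (Icc 0 u) := hh.continuousOn.mono hsubh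
    have hcontg : ContinuousOn g (Icc 0 u) := hg.continuousOn.mono (hsubg'.trans hsubg)
    have hcontd : ContinuousOn (fun s ↦ dist (h s) (g s)) (Icc 0 u) :=
      continuous_dist.comp_continuousOn (hconth.prodMk hcontg)
    set S : Set ℝ := Icc 0 u ∩ (fun s ↦ dist (h s) (g s)) ⁻¹' Ici ((δ : ℝ) / 2) with hSdef
    have hS : IsClosed S := hcontd.preimage_isClosed_of_isClosed isClosed_Icc isClosed_Ici
    have huS : u ∈ S := ⟨⟨hu0, le_rfl⟩, hnot⟩
    have hSbdd : BddBelow S := ⟨0, fun s hs ↦ hs.1.1⟩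
    set s₀ := sInf S with hs₀def
    have hs₀S : s₀ ∈ S := hS.csInf_mem ⟨u, huS⟩ hSbdd
    have hs₀0 : 0 ≤ s₀ := hs₀S.1.1
    have hs₀u : s₀ ≤ u := hs₀S.1.2
    have hbefore : ∀ s, 0 ≤ s → s < s₀ → dist (h s) (g s) < δ / 2 := by
      intro s hs0 hss
      by_contra hge
      rw [not_lt] at hge
      have hsS : s ∈ S := ⟨⟨hs0, hss.le.trans hs₀u⟩, hge⟩
      exact absurd (csInf_le hSbdd hsS) (not_le.2 hss)
    -- Grönwall on `[0, s₀]`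
    have hsub0 : Icc 0 s₀ ⊆ Icc 0 u := Icc_subset_Icc le_rfl hs₀u
    have key := dist_le_of_trajectories_ODE_of_mem (v := vectorField W)
      (s := fun t ↦ {w : ℂ | ((δ / 2 : ℝ≥0) : ℝ) ≤ ‖w - W t.toNNReal‖}) (K := K) (δ := ρ)
      (f := g) (g := h) (a := 0) (b := s₀)
      (fun t _ ↦ lipschitzOnWith_vectorField W t (half_pos hδ))
      (hcontg.mono hsub0) (hg.hasDerivWithinAt_Ici ((hsub0.trans hsubg').trans hsubg))
      (fun s hs ↦ by
        have := hfar s ⟨hs.1, hs.2.le.trans (hs₀u.trans (huc.le.trans hcb.le))⟩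
        show ((δ / 2 : ℝ≥0) : ℝ) ≤ _
        push_cast
        linarith)
      (hconth.mono hsub0) (hh.hasDerivWithinAt_Ici (hsub0.trans hsubh))
      (fun s hs ↦ by
        have h1 := hfar s ⟨hs.1, hs.2.le.trans (hs₀u.trans (huc.le.trans hcb.le))⟩
        have h2 := hbefore s hs.1 hs.2
        rw [dist_eq_norm] at h2
        show ((δ / 2 : ℝ≥0) : ℝ) ≤ _
        push_cast
        have h3 : ‖g s - (W s.toNNReal : ℂ)‖ ≤ ‖h s - W s.toNNReal‖ + ‖h s - g s‖ := by
          calc ‖g s - (W s.toNNReal : ℂ)‖ = ‖(h s - W s.toNNReal) - (h s - g s)‖ := by ring_nf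
            _ ≤ _ := norm_sub_le _ _
        linarith)
      (by rw [hg.apply_zero, hh.apply_zero, dist_comm]; exact hz'.le)
    have hend := key s₀ ⟨hs₀0, le_rfl⟩
    rw [sub_zero] at hend
    have hexp : ρ * Real.exp (K * s₀) ≤ δ / 4 := by
      rw [hρdef, mul_assoc, ← Real.exp_add]
      have : Real.exp (-((K : ℝ) * b) + K * s₀) ≤ 1 := Real.exp_le_one_iff.2 (by
        have : (K : ℝ) * s₀ ≤ K * b :=
          mul_le_mul_of_nonneg_left (hs₀u.trans (huc.le.trans hcb.le)) K.coe_nonneg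
        linarith)
      nlinarith
    have hS₀ : (δ : ℝ) / 2 ≤ dist (h s₀) (g s₀) := hs₀S.2
    rw [dist_comm] at hS₀
    linarith
  -- hence `h` stays `δ/2`-away from `W` on `[0, c)`, contradicting maximality
  have hfar' : ∀ u : ℝ, 0 ≤ u → u < c → ((δ / 2 : ℝ≥0) : ℝ) ≤ ‖h u - W u.toNNReal‖ := by
    intro u hu0 huc
    have h1 := hfar u ⟨hu0, huc.le.trans hcb.le⟩
    have h2 := htube u hu0 huc
    rw [dist_eq_norm] at h2
    push_cast
    have h3 : ‖g u - (W u.toNNReal : ℂ)‖ ≤ ‖h u - W u.toNNReal‖ + ‖h u - g u‖ := by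
      calc ‖g u - (W u.toNNReal : ℂ)‖ = ‖(h u - W u.toNNReal) - (h u - g u)‖ := by ring_nf
        _ ≤ _ := norm_sub_le _ _
    linarith
  have := hh.coe_lt_swallowingTime_of_le_norm_sub hW hc0 (half_pos hδ) hfar'
  rw [← hc] at this
  exact lt_irrefl _ this

/-- **The Loewner domains `H_t` are open** (for a continuous driving function): `H_t = ℍₒ ∩
{z | t < T_z}`. Lawler (2005), Ch. 4 §4.1. [cite: Lawler2005, Ch. 4 §4.1] -/
theorem isOpen_domain (hW : Continuous W) (t : ℝ≥0) : IsOpen (domain W t) := by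
  have : domain W t = upperHalfPlaneSet ∩ {z : ℂ | (t : WithTop ℝ≥0) < swallowingTime W z} := by
    ext z
    rw [mem_domain_iff]
    rfl
  rw [this]
  exact isOpen_upperHalfPlaneSet.inter (isOpen_setOf_lt_swallowingTime hW t)

end Extension

/-! ### Points of `ℍₒ` stay in `ℍₒ`; the hull at time `0` -/

section ImPos

/-- Discharge of `IsSolution.im_pos`: **a solution started in `ℍₒ` stays in `ℍₒ`** (continuous
driving function; Lawler (2005), Ch. 4 §4.1, remark after eq. (4.4)). Proof: if `y = im g`
vanished somewhere, let `s₀` be the first time with `y s₀ ≤ 0`; on `[0, s₀]` the solution stays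
`δ`-away from `W`, so `ẏ = -2y/|g - W|² ≥ -(2/δ²) y` and `y e^{2t/δ²}` is non-decreasing there
(`monotoneOn_of_hasDerivWithinAt_nonneg`), forcing `y s₀ > 0`. [cite: Lawler2005, Ch. 4 §4.1] -/
theorem IsSolution.im_pos_holds : IsSolution.im_pos (W := W) (z := z) (g := g) (T := T) := by
  intro hW h hz t ht htT
  by_contra hle
  rw [not_lt] at hle
  set D : Set ℝ := {t : ℝ | 0 ≤ t ∧ (t.toNNReal : WithTop ℝ≥0) < T} with hDdef
  have hsub : Icc 0 t ⊆ D := Icc_subset_timeDomain htT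
  have hcont : ContinuousOn (fun s ↦ (g s).im) (Icc 0 t) :=
    Complex.continuous_im.comp_continuousOn (h.continuousOn.mono hsub)
  set S : Set ℝ := Icc 0 t ∩ (fun s ↦ (g s).im) ⁻¹' Iic 0 with hSdef
  have hS : IsClosed S := hcont.preimage_isClosed_of_isClosed isClosed_Icc isClosed_Iic
  have htS : t ∈ S := ⟨⟨ht, le_rfl⟩, hle⟩
  have hSbdd : BddBelow S := ⟨0, fun s hs ↦ hs.1.1⟩
  set s₀ := sInf S with hs₀def
  have hs₀S : s₀ ∈ S := hS.csInf_mem ⟨t, htS⟩ hSbdd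
  have hs₀0 : 0 ≤ s₀ := hs₀S.1.1
  have hs₀t : s₀ ≤ t := hs₀S.1.2
  have hpos : ∀ s, 0 ≤ s → s < s₀ → 0 < (g s).im := by
    intro s hs0 hss
    by_contra hge
    rw [not_lt] at hge
    have hsS : s ∈ S := ⟨⟨hs0, hss.le.trans hs₀t⟩, hge⟩
    exact absurd (csInf_le hSbdd hsS) (not_le.2 hss)
  have hs₀pos : 0 < s₀ := by
    rcases eq_or_lt_of_le hs₀0 with h0 | h0
    · exfalso
      have : (g s₀).im ≤ 0 := hs₀S.2
      rw [← h0, h.apply_zero] at this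
      exact absurd hz (not_lt.2 this)
    · exact h0
  -- distance to the driving function on `[0, s₀]`
  have hs₀T : (s₀.toNNReal : WithTop ℝ≥0) < T := (hsub ⟨hs₀0, hs₀t⟩).2
  obtain ⟨δ, hδ, hfar⟩ := h.exists_le_norm_sub hW hs₀0 hs₀T
  have hδ' : (0 : ℝ) < δ := hδ
  have hsub₀ : Icc 0 s₀ ⊆ D := Icc_subset_timeDomain hs₀T
  -- `F s = im (g s) * exp (c s)`, `c = 2/δ²`, is non-decreasing on `[0, s₀]`
  set c : ℝ := 2 / (δ : ℝ) ^ 2 with hcdef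
  have hF : ∀ s ∈ Icc 0 s₀, HasDerivWithinAt (fun s ↦ (g s).im * Real.exp (c * s))
      (-2 * (g s).im / Complex.normSq (g s - W s.toNNReal) * Real.exp (c * s) +
        (g s).im * (Real.exp (c * s) * (c * 1))) (Icc 0 s₀) s := by
    intro s hs
    have h1 : HasDerivWithinAt (fun s ↦ (g s).im) (vectorField W s (g s)).im (Icc 0 s₀) s :=
      Complex.imCLM.hasFDerivAt.comp_hasDerivWithinAt s ((h.isIntegralCurveOn s (hsub₀ hs)).mono hsub₀)
    rw [im_vectorField] at h1
    have h2 : HasDerivWithinAt (fun s ↦ Real.exp (c * s)) (Real.exp (c * s) * (c * 1)) (Icc 0 s₀) s :=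
      ((hasDerivAt_id s).const_mul c).exp.hasDerivWithinAt
    exact h1.mul h2
  have hmono : MonotoneOn (fun s ↦ (g s).im * Real.exp (c * s)) (Icc 0 s₀) := by
    refine monotoneOn_of_hasDerivWithinAt_nonneg (convex_Icc 0 s₀)
      (fun s hs ↦ (hF s hs).continuousWithinAt)
      (fun s hs ↦ (hF s (interior_subset hs)).mono interior_subset) fun s hs ↦ ?_
    rw [interior_Icc] at hs
    have hy : 0 ≤ (g s).im := (hpos s hs.1.le hs.2).le
    have hn : (δ : ℝ) ^ 2 ≤ Complex.normSq (g s - W s.toNNReal) := by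
      rw [Complex.normSq_eq_norm_sq]
      have := hfar s ⟨hs.1.le, hs.2.le⟩
      exact pow_le_pow_left₀ hδ'.le this 2
    have hn0 : 0 < Complex.normSq (g s - W s.toNNReal) := lt_of_lt_of_le (by positivity) hn
    have hrew : -2 * (g s).im / Complex.normSq (g s - W s.toNNReal) * Real.exp (c * s) +
        (g s).im * (Real.exp (c * s) * (c * 1)) =
        Real.exp (c * s) * (g s).im * (c - 2 / Complex.normSq (g s - W s.toNNReal)) := by ring
    rw [hrew]
    refine mul_nonneg (mul_nonneg (Real.exp_pos _).le hy) (sub_nonneg.2 ?_)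
    rw [hcdef]
    exact div_le_div_of_nonneg_left (by norm_num) (by positivity) hn
  have hend := hmono ⟨le_rfl, hs₀0⟩ ⟨hs₀0, le_rfl⟩ hs₀0
  simp only [mul_zero, Real.exp_zero, mul_one] at hend
  rw [h.apply_zero] at hend
  have hy₀ : (g s₀).im ≤ 0 := hs₀S.2
  have : (g s₀).im * Real.exp (c * s₀) ≤ 0 :=
    mul_nonpos_of_nonpos_of_nonneg hy₀ (Real.exp_pos _).le
  linarith

/-- Discharge of `hull_zero`: **the hull at time `0` is empty** (every point of `ℍₒ` is off the
real singularity `W 0` and flows for a positive time, `swallowingTime_pos_holds`).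
Lawler (2005), Ch. 4 §4.1. [cite: Lawler2005, Ch. 4 §4.1] -/
theorem hull_zero_holds : hull_zero (W := W) := by
  intro hW
  ext z
  simp only [hull, mem_setOf_eq, mem_empty_iff_false, iff_false, not_and, not_le]
  intro hz
  have hne : z ≠ W 0 := by
    intro h0
    have : (0 : ℝ) < z.im := hz
    rw [h0, Complex.ofReal_im] at this
    exact lt_irrefl _ this
  simpa using swallowingTime_pos_holds hW hne

end ImPos


/-! ### Reflection symmetry `z ↦ -z̄`, `W ↦ -W` -/

section Reflection

/-- The Loewner field under the reflection `w ↦ -w̄`, `W ↦ -W`: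
`vectorField (-W) t (-w̄) = -conj (vectorField W t w)`. [folklore] -/
theorem vectorField_neg_conj (W : ℝ≥0 → ℝ) (t : ℝ) (w : ℂ) :
    vectorField (fun s ↦ -W s) t (-(starRingEnd ℂ w)) = -(starRingEnd ℂ (vectorField W t w)) := by
  rw [vectorField_apply, vectorField_apply, map_div₀, map_sub, Complex.conj_ofReal, map_ofNat,
    Complex.ofReal_neg]
  rw [show -(starRingEnd ℂ) w - -(W t.toNNReal : ℂ) = -((starRingEnd ℂ) w - W t.toNNReal) by ring,
    div_neg]

/-- **Reflection symmetry of the Loewner flow**: if `g` solves the equation driven by `W` from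
`z`, then `-ḡ` solves the equation driven by `-W` from `-z̄` (Lawler (2005), §6.2 uses the case of
real points: symmetry `x ↦ -x` of chordal SLE). [cite: Lawler2005, Ch. 4 §4.1] -/
theorem IsSolution.neg_conj (h : IsSolution W z g T) :
    IsSolution (fun s ↦ -W s) (-(starRingEnd ℂ z)) (fun t ↦ -(starRingEnd ℂ (g t))) T := by
  refine ⟨by simp [h.apply_zero], fun t ht ↦ ?_, fun t ht htT h0 ↦ ?_⟩
  · have h1 := h.isIntegralCurveOn t ht
    have h2 : HasDerivWithinAt (fun t ↦ starRingEnd ℂ (g t)) (starRingEnd ℂ (vectorField W t (g t)))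
        {t : ℝ | 0 ≤ t ∧ (t.toNNReal : WithTop ℝ≥0) < T} t :=
      Complex.conjCLE.hasFDerivAt.comp_hasDerivWithinAt t h1
    have h3 := h2.neg
    rwa [← vectorField_neg_conj] at h3
  · apply h.ne ht htT
    have h1 : starRingEnd ℂ (g t) = W t.toNNReal := by
      have := congrArg Neg.neg h0
      simp only [neg_neg, Complex.ofReal_neg] at this
      exact this
    have h2 := congrArg (starRingEnd ℂ) h1
    rwa [Complex.conj_conj, Complex.conj_ofReal] at h2

/-- The swallowing time is invariant under the reflection `z ↦ -z̄`, `W ↦ -W`. [folklore] -/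
theorem swallowingTime_neg_conj (W : ℝ≥0 → ℝ) (z : ℂ) :
    swallowingTime (fun s ↦ -W s) (-(starRingEnd ℂ z)) = swallowingTime W z := by
  apply le_antisymm
  · refine sSup_le fun T ⟨g, hg⟩ ↦ le_sSup ⟨fun t ↦ -(starRingEnd ℂ (g t)), ?_⟩
    have := hg.neg_conj
    simp only [neg_neg, map_neg, Complex.conj_conj] at this
    exact this
  · exact sSup_le fun T ⟨g, hg⟩ ↦ le_sSup ⟨fun t ↦ -(starRingEnd ℂ (g t)), hg.neg_conj⟩

/-- Real points: `T_{-x}` for the driving function `-W` is `T_x` for `W`. [folklore] -/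
theorem swallowingTime_neg_ofReal (W : ℝ≥0 → ℝ) (x : ℝ) :
    swallowingTime (fun s ↦ -W s) ((-x : ℝ) : ℂ) = swallowingTime W x := by
  rw [← swallowingTime_neg_conj W x, Complex.conj_ofReal, Complex.ofReal_neg]

end Reflection

/-! ### The real flow: sign and monotonicity -/

section RealFlow

/-- The real part of the Loewner field at a real point `w`: `re (2/(w - W t)) = 2/(re w - W t)`.
[folklore] -/
theorem re_vectorField_of_im_eq_zero (W : ℝ≥0 → ℝ) (t : ℝ) {w : ℂ} (hw : w.im = 0) :
    (vectorField W t w).re = 2 / (w.re - W t.toNNReal) := by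
  have : w - (W t.toNNReal : ℂ) = ((w.re - W t.toNNReal : ℝ) : ℂ) := by
    apply Complex.ext <;> simp [hw]
  rw [vectorField_apply, this, show (2 : ℂ) = ((2 : ℝ) : ℂ) by norm_num, ← Complex.ofReal_div,
    Complex.ofReal_re]

/-- For a real solution, `|g t - W t| = |re (g t) - W t|`. [folklore] -/
theorem norm_sub_driving_of_im_eq_zero {W : ℝ≥0 → ℝ} {t : ℝ} {w : ℂ} (hw : w.im = 0) :
    ‖w - W t.toNNReal‖ = |w.re - W t.toNNReal| := by
  have : w - (W t.toNNReal : ℂ) = ((w.re - W t.toNNReal : ℝ) : ℂ) := by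
    apply Complex.ext <;> simp [hw]
  rw [this, Complex.norm_real, Real.norm_eq_abs]

/-- **A real point to the right of the driving point stays to the right**: if `W 0 < x` then
`W t < re g_t(x)` for all `t < T_x` (the real solution never meets `W` and starts to its right;
intermediate value theorem). Lawler (2005), Ch. 4 §4.1. [cite: Lawler2005, Ch. 4 §4.1] -/
theorem IsSolution.driving_lt_re (hW : Continuous W) {x : ℝ} (h : IsSolution W x g T)
    (hx : W 0 < x) {t : ℝ} (ht : 0 ≤ t) (htT : (t.toNNReal : WithTop ℝ≥0) < T) :
    W t.toNNReal < (g t).re := by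
  have hsub : Icc 0 t ⊆ {s : ℝ | 0 ≤ s ∧ (s.toNNReal : WithTop ℝ≥0) < T} := Icc_subset_timeDomain htT
  have him : ∀ s ∈ Icc 0 t, (g s).im = 0 := fun s hs ↦
    IsSolution.im_eq_zero_holds h (Complex.ofReal_im x) s hs.1 (hsub hs).2
  set p : ℝ → ℝ := fun s ↦ (g s).re - W s.toNNReal with hpdef
  have hcont : ContinuousOn p (Icc 0 t) :=
    (Complex.continuous_re.comp_continuousOn (h.continuousOn.mono hsub)).sub
      (hW.comp continuous_real_toNNReal).continuousOn
  have hp0 : 0 < p 0 := by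
    simp only [hpdef, h.apply_zero, Complex.ofReal_re, Real.toNNReal_zero, sub_pos]
    exact hx
  have hne : ∀ s ∈ Icc 0 t, p s ≠ 0 := fun s hs hps ↦ by
    have h1 := h.ne hs.1 (hsub hs).2
    apply h1
    apply Complex.ext
    · simpa [hpdef, sub_eq_zero] using hps
    · simp [him s hs]
  by_contra hle
  rw [not_lt, ← sub_nonpos] at hle
  obtain ⟨s, hs, hps⟩ : ∃ s ∈ Icc 0 t, p s = 0 := by
    have := intermediate_value_Icc' ht hcont ⟨hle, hp0.le⟩
    exact this
  exact hne s hs hps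

/-- **Comparison of two real solutions on the same side**: if `W 0 < x < x'` and `g, g'` are
the solutions from `x, x'`, then `re g_t(x) < re g_t(x')` as long as both are alive (the
difference `d` satisfies `ḋ = -2d/((g - W)(g' - W))`, so it keeps its sign). Lawler (2005),
Ch. 4 §4.1. [cite: Lawler2005, Ch. 4 §4.1] -/
theorem IsSolution.re_lt_re (hW : Continuous W) {x x' : ℝ} {g' : ℝ → ℂ} {T' : WithTop ℝ≥0}
    (h : IsSolution W x g T) (h' : IsSolution W x' g' T') (hx : W 0 < x) (hxx' : x < x')
    {t : ℝ} (ht : 0 ≤ t) (htT : (t.toNNReal : WithTop ℝ≥0) < T)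
    (htT' : (t.toNNReal : WithTop ℝ≥0) < T') : (g t).re < (g' t).re := by
  have hx' : W 0 < x' := hx.trans hxx'
  have hsub : Icc 0 t ⊆ {s : ℝ | 0 ≤ s ∧ (s.toNNReal : WithTop ℝ≥0) < T} := Icc_subset_timeDomain htT
  have hsub' : Icc 0 t ⊆ {s : ℝ | 0 ≤ s ∧ (s.toNNReal : WithTop ℝ≥0) < T'} :=
    Icc_subset_timeDomain htT'
  have him : ∀ s ∈ Icc 0 t, (g s).im = 0 := fun s hs ↦
    IsSolution.im_eq_zero_holds h (Complex.ofReal_im x) s hs.1 (hsub hs).2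
  have him' : ∀ s ∈ Icc 0 t, (g' s).im = 0 := fun s hs ↦
    IsSolution.im_eq_zero_holds h' (Complex.ofReal_im x') s hs.1 (hsub' hs).2
  -- positivity of `p = re g - W`, `p' = re g' - W` on `[0, t]`
  have hp : ∀ s ∈ Icc 0 t, 0 < (g s).re - W s.toNNReal := fun s hs ↦
    sub_pos.2 (h.driving_lt_re hW hx hs.1 (hsub hs).2)
  have hp' : ∀ s ∈ Icc 0 t, 0 < (g' s).re - W s.toNNReal := fun s hs ↦
    sub_pos.2 (h'.driving_lt_re hW hx' hs.1 (hsub' hs).2)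
  -- the difference `d = re g' - re g` and its first non-positive time
  set d : ℝ → ℝ := fun s ↦ (g' s).re - (g s).re with hddef
  by_contra hle
  rw [not_lt, ← sub_nonpos] at hle
  have hcontd : ContinuousOn d (Icc 0 t) :=
    (Complex.continuous_re.comp_continuousOn (h'.continuousOn.mono hsub')).sub
      (Complex.continuous_re.comp_continuousOn (h.continuousOn.mono hsub))
  set S : Set ℝ := Icc 0 t ∩ d ⁻¹' Iic 0 with hSdef
  have hS : IsClosed S := hcontd.preimage_isClosed_of_isClosed isClosed_Icc isClosed_Iic
  have htS : t ∈ S := ⟨⟨ht, le_rfl⟩, hle⟩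
  have hSbdd : BddBelow S := ⟨0, fun s hs ↦ hs.1.1⟩
  set s₀ := sInf S with hs₀def
  have hs₀S : s₀ ∈ S := hS.csInf_mem ⟨t, htS⟩ hSbdd
  have hs₀0 : 0 ≤ s₀ := hs₀S.1.1
  have hs₀t : s₀ ≤ t := hs₀S.1.2
  have hdpos : ∀ s, 0 ≤ s → s < s₀ → 0 < d s := by
    intro s hs0 hss
    by_contra hge
    rw [not_lt] at hge
    have hsS : s ∈ S := ⟨⟨hs0, hss.le.trans hs₀t⟩, hge⟩
    exact absurd (csInf_le hSbdd hsS) (not_le.2 hss)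
  have hd0 : 0 < d 0 := by
    simp only [hddef, h.apply_zero, h'.apply_zero, Complex.ofReal_re, sub_pos]
    exact hxx'
  have hs₀pos : 0 < s₀ := by
    rcases eq_or_lt_of_le hs₀0 with h0 | h0
    · exfalso
      have : d s₀ ≤ 0 := hs₀S.2
      rw [← h0] at this
      exact absurd hd0 (not_lt.2 this)
    · exact h0
  -- lower bound `δ` for both distances to `W` on `[0, s₀]`
  have hsub₀ : Icc 0 s₀ ⊆ Icc 0 t := Icc_subset_Icc le_rfl hs₀t
  obtain ⟨δ₁, hδ₁, hfar₁⟩ := h.exists_le_norm_sub hW hs₀0 (hsub (hsub₀ ⟨hs₀0, le_rfl⟩)).2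
  obtain ⟨δ₂, hδ₂, hfar₂⟩ := h'.exists_le_norm_sub hW hs₀0 (hsub' (hsub₀ ⟨hs₀0, le_rfl⟩)).2
  set δ := min δ₁ δ₂ with hδdef
  have hδ : 0 < δ := lt_min hδ₁ hδ₂
  have hδ' : (0 : ℝ) < δ := hδ
  have hpδ : ∀ s ∈ Icc 0 s₀, (δ : ℝ) ≤ (g s).re - W s.toNNReal := fun s hs ↦ by
    have h1 := hfar₁ s hs
    rw [norm_sub_driving_of_im_eq_zero (him s (hsub₀ hs)), abs_of_pos (hp s (hsub₀ hs))] at h1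
    exact le_trans (NNReal.coe_le_coe.2 (min_le_left _ _)) h1
  have hp'δ : ∀ s ∈ Icc 0 s₀, (δ : ℝ) ≤ (g' s).re - W s.toNNReal := fun s hs ↦ by
    have h1 := hfar₂ s hs
    rw [norm_sub_driving_of_im_eq_zero (him' s (hsub₀ hs)), abs_of_pos (hp' s (hsub₀ hs))] at h1
    exact le_trans (NNReal.coe_le_coe.2 (min_le_right _ _)) h1
  -- `F s = d s * exp (c s)`, `c = 2/δ²`, is non-decreasing on `[0, s₀]`
  set c : ℝ := 2 / (δ : ℝ) ^ 2 with hcdef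
  have hsubD₀ : Icc 0 s₀ ⊆ {s : ℝ | 0 ≤ s ∧ (s.toNNReal : WithTop ℝ≥0) < T} := hsub₀.trans hsub
  have hsubD₀' : Icc 0 s₀ ⊆ {s : ℝ | 0 ≤ s ∧ (s.toNNReal : WithTop ℝ≥0) < T'} := hsub₀.trans hsub'
  have hF : ∀ s ∈ Icc 0 s₀, HasDerivWithinAt (fun s ↦ d s * Real.exp (c * s))
      ((2 / ((g' s).re - W s.toNNReal) - 2 / ((g s).re - W s.toNNReal)) * Real.exp (c * s) +
        d s * (Real.exp (c * s) * (c * 1))) (Icc 0 s₀) s := by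
    intro s hs
    have h1 : HasDerivWithinAt (fun s ↦ (g s).re) (vectorField W s (g s)).re (Icc 0 s₀) s :=
      Complex.reCLM.hasFDerivAt.comp_hasDerivWithinAt s
        ((h.isIntegralCurveOn s (hsubD₀ hs)).mono hsubD₀)
    have h1' : HasDerivWithinAt (fun s ↦ (g' s).re) (vectorField W s (g' s)).re (Icc 0 s₀) s :=
      Complex.reCLM.hasFDerivAt.comp_hasDerivWithinAt s
        ((h'.isIntegralCurveOn s (hsubD₀' hs)).mono hsubD₀')
    rw [re_vectorField_of_im_eq_zero W s (him s (hsub₀ hs))] at h1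
    rw [re_vectorField_of_im_eq_zero W s (him' s (hsub₀ hs))] at h1'
    have h2 : HasDerivWithinAt (fun s ↦ Real.exp (c * s)) (Real.exp (c * s) * (c * 1))
        (Icc 0 s₀) s := ((hasDerivAt_id s).const_mul c).exp.hasDerivWithinAt
    exact (h1'.sub h1).mul h2
  have hmono : MonotoneOn (fun s ↦ d s * Real.exp (c * s)) (Icc 0 s₀) := by
    refine monotoneOn_of_hasDerivWithinAt_nonneg (convex_Icc 0 s₀)
      (fun s hs ↦ (hF s hs).continuousWithinAt)
      (fun s hs ↦ (hF s (interior_subset hs)).mono interior_subset) fun s hs ↦ ?_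
    rw [interior_Icc] at hs
    have hsI : s ∈ Icc 0 s₀ := ⟨hs.1.le, hs.2.le⟩
    have hy : 0 ≤ d s := (hdpos s hs.1.le hs.2).le
    set P := (g s).re - W s.toNNReal with hP
    set P' := (g' s).re - W s.toNNReal with hP'
    have hP0 : (δ : ℝ) ≤ P := hpδ s hsI
    have hP'0 : (δ : ℝ) ≤ P' := hp'δ s hsI
    have hPpos : 0 < P := hδ'.trans_le hP0
    have hP'pos : 0 < P' := hδ'.trans_le hP'0
    have hdP : d s = P' - P := by simp only [hddef, hP, hP']; ring
    have hrew : (2 / P' - 2 / P) * Real.exp (c * s) + d s * (Real.exp (c * s) * (c * 1)) =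
        Real.exp (c * s) * d s * (c - 2 / (P * P')) := by
      rw [hdP]
      field_simp
      ring
    rw [hrew]
    refine mul_nonneg (mul_nonneg (Real.exp_pos _).le hy) (sub_nonneg.2 ?_)
    rw [hcdef]
    have hprod : (δ : ℝ) ^ 2 ≤ P * P' := by
      rw [sq]
      exact mul_le_mul hP0 hP'0 hδ'.le hPpos.le
    exact div_le_div_of_nonneg_left (by norm_num) (by positivity) hprod
  have hend := hmono ⟨le_rfl, hs₀0⟩ ⟨hs₀0, le_rfl⟩ hs₀0
  simp only [mul_zero, Real.exp_zero, mul_one] at hend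
  have hy₀ : d s₀ ≤ 0 := hs₀S.2
  have : d s₀ * Real.exp (c * s₀) ≤ 0 := mul_nonpos_of_nonpos_of_nonneg hy₀ (Real.exp_pos _).le
  linarith

/-- **Monotonicity of swallowing times on the real line (right of the driving point)**: for a
continuous driving function and `W 0 < x ≤ x'`, `T_x ≤ T_{x'}` — the point closer to the driving
point is swallowed first (Lawler (2005), Ch. 4 §4.1 / §6.2: `x ↦ T_x` is non-decreasing on
`(0, ∞)`). Proof: if `T_{x'} < T_x`, then on `[0, T_{x'})` one has
`re g_t(x') - W_t > re g_t(x) - W_t ≥ δ > 0` (`IsSolution.re_lt_re` and compactness of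
`[0, T_{x'}] ⊂ [0, T_x)`), contradicting the extension criterion for the maximal solution from
`x'`. [cite: Lawler2005, Ch. 4 §4.1] -/
theorem swallowingTime_mono_right (hW : Continuous W) {x x' : ℝ} (hx : W 0 < x) (hxx' : x ≤ x') :
    swallowingTime W x ≤ swallowingTime W x' := by
  rcases eq_or_lt_of_le hxx' with rfl | hlt
  · exact le_rfl
  by_contra hcon
  rw [not_le] at hcon
  have hx0 : (x : ℂ) ≠ W 0 := fun h0 ↦ by
    have := congrArg Complex.re h0
    simp only [Complex.ofReal_re] at this
    exact hx.ne' this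
  have hx'0 : (x' : ℂ) ≠ W 0 := fun h0 ↦ by
    have := congrArg Complex.re h0
    simp only [Complex.ofReal_re] at this
    exact (hx.trans hlt).ne' this
  obtain ⟨g₁, hg₁⟩ := exists_isSolution_swallowingTime_holds hW hx0
  obtain ⟨g₂, hg₂⟩ := exists_isSolution_swallowingTime_holds hW hx'0
  -- the finite lifetime `b` of the solution from `x'`
  have hbT : swallowingTime W x' ≠ ⊤ := ne_top_of_lt hcon
  obtain ⟨b, hb⟩ := WithTop.ne_top_iff_exists.1 hbT
  rw [← hb] at hg₂ hcon
  have hb0 : 0 < b := by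
    have := swallowingTime_pos_holds hW hx'0
    rw [← hb] at this
    exact WithTop.coe_pos.1 this
  -- `g₁` is alive on `[0, b]`, at distance `≥ δ` from `W`
  have hbT₁ : ((b : ℝ).toNNReal : WithTop ℝ≥0) < swallowingTime W x := by rwa [Real.toNNReal_coe]
  obtain ⟨δ, hδ, hfar⟩ := hg₁.exists_le_norm_sub hW b.coe_nonneg hbT₁
  have hDb : ∀ s, s ∈ {t : ℝ | 0 ≤ t ∧ (t.toNNReal : WithTop ℝ≥0) < (b : WithTop ℝ≥0)} ↔
      0 ≤ s ∧ s < b := fun s ↦ mem_timeDomain_coe_iff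
  have hfar₂ : ∀ t : ℝ, 0 ≤ t → t < b → (δ : ℝ) ≤ ‖g₂ t - W t.toNNReal‖ := by
    intro t ht htb
    have htT₁ : (t.toNNReal : WithTop ℝ≥0) < swallowingTime W x :=
      (Icc_subset_timeDomain hbT₁ ⟨ht, htb.le⟩).2
    have htT₂ : (t.toNNReal : WithTop ℝ≥0) < (b : WithTop ℝ≥0) := ((hDb t).2 ⟨ht, htb⟩).2
    have h1 := hfar t ⟨ht, htb.le⟩
    have him₁ : (g₁ t).im = 0 := IsSolution.im_eq_zero_holds hg₁ (Complex.ofReal_im x) t ht htT₁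
    have him₂ : (g₂ t).im = 0 := IsSolution.im_eq_zero_holds hg₂ (Complex.ofReal_im x') t ht htT₂
    have hp₁ : 0 < (g₁ t).re - W t.toNNReal := sub_pos.2 (hg₁.driving_lt_re hW hx ht htT₁)
    have hlt' := hg₁.re_lt_re hW hg₂ hx hlt ht htT₁ htT₂
    rw [norm_sub_driving_of_im_eq_zero him₁, abs_of_pos hp₁] at h1
    rw [norm_sub_driving_of_im_eq_zero him₂, abs_of_pos (by linarith)]
    linarith
  have := hg₂.coe_lt_swallowingTime_of_le_norm_sub hW hb0 hδ hfar₂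
  rw [← hb] at this
  exact lt_irrefl _ this

/-- **Monotonicity of swallowing times on the real line (left of the driving point)**: for
`x' ≤ x < W 0`, `T_x ≤ T_{x'}` (reflection `z ↦ -z̄`, `W ↦ -W` of `swallowingTime_mono_right`).
[cite: Lawler2005, Ch. 4 §4.1] -/
theorem swallowingTime_mono_left (hW : Continuous W) {x x' : ℝ} (hx : x < W 0) (hxx' : x' ≤ x) :
    swallowingTime W x ≤ swallowingTime W x' := by
  rw [← swallowingTime_neg_ofReal W x, ← swallowingTime_neg_ofReal W x']
  exact swallowingTime_mono_right (W := fun s ↦ -W s) (hW.neg) (by simpa using hx)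
    (by simpa using hxx')

end RealFlow

end Loewner

end Literature.Probability.RandomPlanarGeometry
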